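import Summits.MatrixMultiplication.OmegaCensus.STPPSmallPatternKernelReflect122D
import Literature.NumberTheory.EllipticCurves.IwasawaDualModule

/-!
# ω-census, small STPP pattern `(1,2,2)^k`: reflection with PARAMETRISED maps (generator images)

HONEST FRAMING (pub-omega census; verbatim): lottery ticket; floor = certified bounds/negative ranges.
Census STRUCTURE bookkeeping of the STPP track (seat pub-omega-stpp-3, gen 24; STRUCTURE row B5, column `T2`), not progress on `ω`.

`STPPSmallPatternKernelReflect122D.lean` reduces the first level of the `(1,2,2)^k` kernel search by covering maps, stabiliser maps
and the `B ↔ C` duality, with the maps given as lists of functions.  Kernel cells want the maps as DATA: a parametrisation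
`mk : ι → (G → G)` (e.g. `ι = G × G`, `mk (h₁, h₂) x = x₁.val • h₁ + x₂.val • h₂` — generator images) and lists of parameters.
This file gives
* `not_exists_isSTPP_122_of_search2x_dualP` — the reflection theorem in that form, with INJECTIVITY replaced by the cheaper
  kernel-triviality `∀ x, mk i x = 0 → x = 0` (equivalent for additive maps);
* `additive_gen₁ … additive_gen₅` — additivity of generator-image maps `x ↦ Σ xᵢ.val • hᵢ` on `ℤ/n`,
  `ℤ/m₁ × ℤ/m₂`, … (up to five factors) from the order conditions `mᵢ • hᵢ = 0` (so cells decide only the order conditions;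
  the periodicity step is `IwasawaDual.mod_smul_eq` of the Literature tree).

References: H. Cohn, R. Kleinberg, B. Szegedy, C. Umans, FOCS 2005 (arXiv:math/0511460), Def. 5.1.
-/

namespace Summit.MatrixMultiplication.OmegaCensus

namespace STPP122Neg

open STPP211Neg Literature.Computability.AlgebraicComplexity

section Gen

variable {A : Type*} [AddCommGroup A]

/-- Additivity of `x ↦ x.val • h` on `ℤ/n` when `n • h = 0`. -/
theorem additive_gen₁ {n : ℕ} [NeZero n] (h : A) (H : n • h = 0) (a b : ZMod n) :
    (a + b).val • h = a.val • h + b.val • h := by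
  rw [ZMod.val_add, Literature.NumberTheory.EllipticCurves.IwasawaDual.mod_smul_eq H, add_nsmul]

/-- Additivity of `x ↦ x.1.val • h₁ + x.2.val • h₂` on `ℤ/m₁ × ℤ/m₂` when `mᵢ • hᵢ = 0`. -/
theorem additive_gen₂ {m₁ m₂ : ℕ} [NeZero m₁] [NeZero m₂] (h₁ h₂ : A) (H₁ : m₁ • h₁ = 0) (H₂ : m₂ • h₂ = 0)
    (a b : ZMod m₁ × ZMod m₂) :
    (a + b).1.val • h₁ + (a + b).2.val • h₂ = (a.1.val • h₁ + a.2.val • h₂) + (b.1.val • h₁ + b.2.val • h₂) := by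
  rw [Prod.fst_add, Prod.snd_add, additive_gen₁ h₁ H₁, additive_gen₁ h₂ H₂]
  abel

/-- Additivity of `x ↦ x.1.val • h₁ + x.2.1.val • h₂ + x.2.2.val • h₃` on `ℤ/m₁ × (ℤ/m₂ × ℤ/m₃)` when `mᵢ • hᵢ = 0`. -/
theorem additive_gen₃ {m₁ m₂ m₃ : ℕ} [NeZero m₁] [NeZero m₂] [NeZero m₃] (h₁ h₂ h₃ : A) (H₁ : m₁ • h₁ = 0)
    (H₂ : m₂ • h₂ = 0) (H₃ : m₃ • h₃ = 0) (a b : ZMod m₁ × (ZMod m₂ × ZMod m₃)) :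
    (a + b).1.val • h₁ + (a + b).2.1.val • h₂ + (a + b).2.2.val • h₃ =
      (a.1.val • h₁ + a.2.1.val • h₂ + a.2.2.val • h₃) + (b.1.val • h₁ + b.2.1.val • h₂ + b.2.2.val • h₃) := by
  rw [Prod.fst_add, Prod.snd_add, Prod.fst_add, Prod.snd_add, additive_gen₁ h₁ H₁, additive_gen₁ h₂ H₂, additive_gen₁ h₃ H₃]
  abel

/-- Additivity on `ℤ/m₁ × (ℤ/m₂ × (ℤ/m₃ × ℤ/m₄))`. -/
theorem additive_gen₄ {m₁ m₂ m₃ m₄ : ℕ} [NeZero m₁] [NeZero m₂] [NeZero m₃] [NeZero m₄] (h₁ h₂ h₃ h₄ : A)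
    (H₁ : m₁ • h₁ = 0) (H₂ : m₂ • h₂ = 0) (H₃ : m₃ • h₃ = 0) (H₄ : m₄ • h₄ = 0)
    (a b : ZMod m₁ × (ZMod m₂ × (ZMod m₃ × ZMod m₄))) :
    (a + b).1.val • h₁ + (a + b).2.1.val • h₂ + (a + b).2.2.1.val • h₃ + (a + b).2.2.2.val • h₄ =
      (a.1.val • h₁ + a.2.1.val • h₂ + a.2.2.1.val • h₃ + a.2.2.2.val • h₄) +
        (b.1.val • h₁ + b.2.1.val • h₂ + b.2.2.1.val • h₃ + b.2.2.2.val • h₄) := by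
  rw [Prod.fst_add, Prod.snd_add, Prod.fst_add, Prod.snd_add, Prod.fst_add, Prod.snd_add, additive_gen₁ h₁ H₁,
    additive_gen₁ h₂ H₂, additive_gen₁ h₃ H₃, additive_gen₁ h₄ H₄]
  abel

/-- Additivity on `ℤ/m₁ × (ℤ/m₂ × (ℤ/m₃ × (ℤ/m₄ × ℤ/m₅)))`. -/
theorem additive_gen₅ {m₁ m₂ m₃ m₄ m₅ : ℕ} [NeZero m₁] [NeZero m₂] [NeZero m₃] [NeZero m₄] [NeZero m₅]
    (h₁ h₂ h₃ h₄ h₅ : A) (H₁ : m₁ • h₁ = 0) (H₂ : m₂ • h₂ = 0) (H₃ : m₃ • h₃ = 0) (H₄ : m₄ • h₄ = 0) (H₅ : m₅ • h₅ = 0)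
    (a b : ZMod m₁ × (ZMod m₂ × (ZMod m₃ × (ZMod m₄ × ZMod m₅)))) :
    (a + b).1.val • h₁ + (a + b).2.1.val • h₂ + (a + b).2.2.1.val • h₃ + (a + b).2.2.2.1.val • h₄ +
        (a + b).2.2.2.2.val • h₅ =
      (a.1.val • h₁ + a.2.1.val • h₂ + a.2.2.1.val • h₃ + a.2.2.2.1.val • h₄ + a.2.2.2.2.val • h₅) +
        (b.1.val • h₁ + b.2.1.val • h₂ + b.2.2.1.val • h₃ + b.2.2.2.1.val • h₄ + b.2.2.2.2.val • h₅) := by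
  rw [Prod.fst_add, Prod.snd_add, Prod.fst_add, Prod.snd_add, Prod.fst_add, Prod.snd_add, Prod.fst_add, Prod.snd_add,
    additive_gen₁ h₁ H₁, additive_gen₁ h₂ H₂, additive_gen₁ h₃ H₃, additive_gen₁ h₄ H₄, additive_gen₁ h₅ H₅]
  abel

end Gen

section Refl

variable {G : Type} [AddCommGroup G] {K : ℕ}

/-- An additive function with trivial kernel is injective. -/
theorem injective_of_additive_of_ker {f : G → G} (hadd : ∀ a b : G, f (a + b) = f a + f b)
    (hker : ∀ x : G, f x = 0 → x = 0) : Function.Injective f :=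
  (injective_iff_map_eq_zero (AddMonoidHom.mk' f hadd)).2 hker

/-- **REFLECTION THROUGH DEF. 5.1, chunked search, stabiliser + duality cover — PARAMETRISED-MAP FORM** (pattern `(1,2,2)^k`):
the covering maps are `mkA i`, `i ∈ IA`, the stabiliser maps `mkS j`, `j ∈ IS` (any parametrisations, e.g. generator images);
the hypotheses are additivity, kernel-triviality, the cover of the representatives, and the stabiliser/duality cover of the
first-level codes — all decidable statements about the parameter LISTS.  [cite: CohnKleinbergSzegedyUmans2005, Def. 5.1] -/
theorem not_exists_isSTPP_122_of_search2x_dualP [DecidableEq G] (E : GEnc G) (hK : 0 < K) {chunks : List (ℕ × ℕ)}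
    (hsearch : search2x E.g K chunks = true) {reps : List ℕ} {ι κ : Type*} (mkA : ι → G → G) (IA : List ι)
    (haddA : ∀ i ∈ IA, ∀ a b : G, mkA i (a + b) = mkA i a + mkA i b) (hkerA : ∀ i ∈ IA, ∀ x : G, mkA i x = 0 → x = 0)
    (hcover : ∀ d : G, d ≠ 0 → ∃ i ∈ IA, E.enc (mkA i d) ∈ reps)
    (mkS : κ → G → G) (IS : List κ)
    (haddS : ∀ j ∈ IS, ∀ a b : G, mkS j (a + b) = mkS j a + mkS j b) (hkerS : ∀ j ∈ IS, ∀ x : G, mkS j x = 0 → x = 0)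
    (hchunks : ∀ d : G, E.enc d ∈ reps → ∀ z : G,
      (∃ j ∈ IS, mkS j d = d ∧ ∃ e ∈ chunks, e.1 = E.enc d ∧ e.2.testBit (E.enc (mkS j z)) = false) ∨
      (∃ i ∈ IA, E.enc (mkA i (-z)) ∈ reps ∧ ∃ j ∈ IS, mkS j (mkA i (-z)) = mkA i (-z) ∧
        ∃ e ∈ chunks, e.1 = E.enc (mkA i (-z)) ∧ e.2.testBit (E.enc (mkS j (mkA i (-d)))) = false)) :
    ¬ ∃ A B C : Fin K → Finset G, IsSTPP A B C ∧ ∀ i, (A i).card = 1 ∧ (B i).card = 2 ∧ (C i).card = 2 := by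
  refine not_exists_isSTPP_122_of_search2x_dualF E hK hsearch (reps := reps) (auts := IA.map mkA) (stabs := IS.map mkS)
    (fun f hf => ?_) (fun f hf => ?_) (fun d hd => ?_) (fun f hf => ?_) (fun f hf => ?_) (fun d hd z => ?_)
  · obtain ⟨i, hi, rfl⟩ := List.mem_map.1 hf; exact haddA i hi
  · obtain ⟨i, hi, rfl⟩ := List.mem_map.1 hf; exact injective_of_additive_of_ker (haddA i hi) (hkerA i hi)
  · obtain ⟨i, hi, h⟩ := hcover d hd; exact ⟨mkA i, List.mem_map.2 ⟨i, hi, rfl⟩, h⟩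
  · obtain ⟨j, hj, rfl⟩ := List.mem_map.1 hf; exact haddS j hj
  · obtain ⟨j, hj, rfl⟩ := List.mem_map.1 hf; exact injective_of_additive_of_ker (haddS j hj) (hkerS j hj)
  · rcases hchunks d hd z with ⟨j, hj, hjd, hrest⟩ | ⟨i, hi, hid, j, hj, hjd, hrest⟩
    · exact Or.inl ⟨mkS j, List.mem_map.2 ⟨j, hj, rfl⟩, hjd, hrest⟩
    · exact Or.inr ⟨mkA i, List.mem_map.2 ⟨i, hi, rfl⟩, hid, mkS j, List.mem_map.2 ⟨j, hj, rfl⟩, hjd, hrest⟩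

end Refl

end STPP122Neg

end Summit.MatrixMultiplication.OmegaCensus
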